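/- Copyright: the b2b-balaban cell (near-miss cell 7), T⁴-continuum fan-out; row NE7b CRUX team (2), seat
t4-ne7b-formalise-leaf-05 (gen 33) — IR-46-2's standing division «… leaf-05 toy-instantiates» applied to the custodian
leaf-03 g27's IR-49-1 «THE FIBRE DECORATION» reading-side record `IndexDecor` (`HistoryRealiseCellsRunSupplyFibreWTVS`),
part 8 of the sanity series (`CLAIMS.log` l.33876).  Released under the licence of the surrounding project. -/
import Summits.QuantumFields.BalabanUV.T4Continuum.Support.HistoryRealiseCellsRunAssemblyWTVSSanityLW
import Summits.QuantumFields.BalabanUV.T4Continuum.Support.HistoryRealiseCellsRunSupplyFibreWTVS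

/-!
# Sanity for the (α) assembly, part 8: THE FIBRE DECORATION `IndexDecor` ON THE TOY READINGS — EMPTY DATA, (ρ0) BY
CONSTRUCTION — AND THE RECORDS' `hρ` THROUGH THE CUSTODIAN's ONE-LINER `hρ_of_indexDecor` (companion of
`HistoryRealiseCellsRunSupplyFibreWTVS`; lineage `t4-ne7b-formalise-leaf-05` gen 33)

Summits-side support leaf of the T⁴-continuum cell (rung (B)+1 on a FINITE torus only; NOT infinite volume, NOT the
mass gap, NOT Clay; NOT a proof of NE7b — NOT PRINTED, NOT PROVED).  [decided toy] over part 1 (`ℛ₃`, `Φ₃`), part 5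
(`ℛ₄`, `Φ₄`, `died_run_eq_empty₄`) and the custodian's IR-49-1 (`IndexDecor`, `hρ_of_indexDecor`), REUSED BY NAME; nothing
printed asserted, no `def … : Prop` fact, no cite-tagged hypothesis, zero `sorry`.

WHAT.  On a reading with NO live name every key-quantified display of `IndexDecor` (`hsl hmem hinj envelope hW card_Dec`)
is VACUOUS (`not_mem_badGMems₃`∕`₄`); (ρ0) `died_empty` holds BY CONSTRUCTION (no region ⇒ nothing dies); «FIBRE-1» `hN`
at `N := 0`; `v := 0`.  Hence **`indexDecor_toy₃`** (part 1's reading `ℛ₃ L`, letters `Φ₃`) and **`indexDecor_toy₄`** (part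
5's `ℛ₄ L Rc`, letters `Φ₄`) at ANY `l₀ K₀ W φB φR`, with `δ := κ := Unit` and EMPTY decoration ∕ slice sets; and the
records' located display (ρ) in EXACTLY the field shape of `HistReadDataL.hρ` ∕ `HistReadDataLW.hρ` through
`hρ_of_indexDecor` — **`hρ_toy₃_of_indexDecor`**, **`hρ_toy₄_of_indexDecor`** (the road the planned «record minus `hρ` plus
`IndexDecor`» twins will take, run on the toy first).

HONEST.  Certifies «no display of `IndexDecor` unsatisfiable as typed» at EMPTY data only — nothing about Bałaban's index
reading (ρ1), envelopes (ρ2) or the share check (ρ3) on members of a real reading; BY-NAME EFFECT ON THE WALL: NONE; NE7b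
NOT proved; spine 0∕9.  HONEST DEPENDENCY (cell): continuum YM on T⁴ ⇐ BetaPertH ∧ nine spine estimates (0/9 proved);
BetaPertH ⇐ (D1) ∧ (D4) ∧ CAP+tail; G-an2-4 gates asym, D1 and NE2/3/4.  Unchanged here.
-/

open Finset MeasureTheory
open Literature.MathematicalPhysics.QuantumFieldTheory.Balaban1983to89
open T4PersistenceDictionary T4PersistentHistoryCount T4BankedInduction T4PrintedShapeBanking
open T4WeightBudget T4GlobalDenominator T4LiveClassFibration T4LiveStructureGas T4LiveGasToTerms T4RecordPriceSeam
open T4PartnerMultiplicity T4IndicatorShell T4MatchingAssembly T4MatchingClosure T4MatchingClosureSocket T4Continuum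
open T4StabilitySocket T4BranchingRecordsGas T4TaggedShapeBanking T4CanonicalMenus T4RenewalChains
open Summit.QuantumFields.BalabanUV.T4Continuum.HistoryFlow Summit.QuantumFields.BalabanUV.T4Continuum.HistoryGen
open Summit.QuantumFields.BalabanUV.T4Continuum.HistoryGenealogyRealise
open Summit.QuantumFields.BalabanUV.T4Continuum.HistoryGenealogyInstantiate
open Summit.QuantumFields.BalabanUV.T4Continuum.HistoryAssemblyTerms
open Summit.QuantumFields.BalabanUV.T4Continuum.HistoryAssemblyMult Summit.QuantumFields.BalabanUV.T4Continuum.HistoryAssemblyMultKey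
open Summit.QuantumFields.BalabanUV.T4Continuum.HistorySocketTH
open Summit.QuantumFields.BalabanUV.T4Continuum.HistoryRealiseCellsRunApexT3bWTVS
open Summit.QuantumFields.BalabanUV.T4Continuum.B16HistoryIndexedRepr
open Summit.QuantumFields.BalabanUV.T4Continuum.HistoryConstants Summit.QuantumFields.BalabanUV.T4Continuum.HistoryBankingDiscountCharge
open Summit.QuantumFields.BalabanUV.T4Continuum.HistoryBankingCreditRead
open Summit.QuantumFields.BalabanUV.T4Continuum.HistoryBankingFibreRoom
open Summit.QuantumFields.BalabanUV.T4Continuum.HistoryPriceNodeSum Summit.QuantumFields.BalabanUV.T4Continuum.HistoryPriceKeys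
open Summit.QuantumFields.BalabanUV.T4Continuum.HistoryRealiseCellsRunSupplyWTVS
open Summit.QuantumFields.BalabanUV.T4Continuum.HistoryRealiseCellsRunSupplyKeysWTVS
open Summit.QuantumFields.BalabanUV.T4Continuum.HistoryRealiseCellsRunSupplyWTVSSanity
open Summit.QuantumFields.BalabanUV.T4Continuum.HistoryRealiseCellsRunAssemblyWTVSData
open Summit.QuantumFields.BalabanUV.T4Continuum.HistoryRealiseCellsRunSupplyFibreWTVS
open Summit.QuantumFields.BalabanUV.T4Continuum.HistoryBankingVolumeWindow (lamVol)

namespace Summit.QuantumFields.BalabanUV.T4Continuum.HistoryRealiseCellsRunAssemblyWTVSSanity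

noncomputable section

open B16HistoryIndexedRepr.Sanity B16HistoryIndexedRepr.SanityInput HistoryConstants.Sanity

set_option synthInstance.maxSize 1024

/-! ## §8 The fibre decoration on the toy readings: empty data -/

/-- **`IndexDecor` ON PART 1's NO-REGION TOY READING `ℛ₃ L`** (letters `Φ₃ L g Z`; any `l₀ K₀ W φB φR`): EMPTY decoration and
slice data, every key-quantified display VACUOUS, (ρ0) by construction, «FIBRE-1» at `N := 0`. [decided toy] -/
def indexDecor_toy₃ (L n : ℕ) (hn : 0 < n) (hL : 2 ≤ L) (g : ℕ → ℕ → ℝ) (Z : ℕ → ℝ → ℝ) (l₀ : ℝ) (K₀ : ℕ) (W : ℕ → ℝ)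
    (φB : ℕ → ℕ → ℕ → ℝ) (φR : ℕ → ℕ → ℝ) :
    IndexDecor (ℛ₃ L) (Φ₃ L g Z) l₀ K₀ W φB φR (cellA n L (ℛ₃ L))
      (physA n L hn (lt_of_lt_of_le (by norm_num) hL) (ℛ₃ L)) jhalf Unit Unit where
  Dec _ _ := ∅
  dec _ _ _ := ()
  Csl _ _ := ∅
  slice _ _ _ := ()
  v _ _ _ _ := 0
  N _ _ := 0
  died_empty K _ τ _ j _ := ((ℛ₃ L).inputOf.run K τ).died_histV_eq_empty_of_N (fun _ => rfl) j
  hsl K _ k hk := absurd hk (not_mem_badGMems₃ L _ _ jhalf K k)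
  hmem K _ k hk := absurd hk (not_mem_badGMems₃ L _ _ jhalf K k)
  hinj K _ k hk := absurd hk (not_mem_badGMems₃ L _ _ jhalf K k)
  v_nonneg _ _ _ _ _ := le_rfl
  envelope K _ _ _ k hk := absurd hk (not_mem_badGMems₃ L _ _ jhalf K k)
  hW K _ _ _ k hk := absurd hk (not_mem_badGMems₃ L _ _ jhalf K k)
  card_Dec K _ k hk := absurd hk (not_mem_badGMems₃ L _ _ jhalf K k)
  hN K e := by simpa using (Real.exp_pos _).le

/-- **`IndexDecor` ON PART 5's TOY READING `ℛ₄ L Rc` OF CONSTANT SIZE** (the prefix twin's letters `Φ₄`; any `l₀ K₀ W φB φR`):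
the same empty data; (ρ0) by `died_run_eq_empty₄`. [decided toy] -/
def indexDecor_toy₄ (L Rc n : ℕ) (hn : 0 < n) (hL : 2 ≤ L) (O : PrintedO1s) (m : ℝ) (C : T4PrintedShapeBanking.Consts)
    (Lr : ℝ) (p₁ : ℕ) (cΛ : ℝ) (g : ℕ → ℕ → ℝ) (Z : ℕ → ℝ → ℝ) (hΛ1 : ∀ K t, 1 ≤ lamVol cΛ (g K) K t) (l₀ : ℝ) (K₀ : ℕ)
    (W : ℕ → ℝ) (φB : ℕ → ℕ → ℕ → ℝ) (φR : ℕ → ℕ → ℝ) :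
    IndexDecor (ℛ₄ L Rc) (Φ₄ O m C Lr p₁ Rc cΛ g Z hΛ1) l₀ K₀ W φB φR (cellA n L (ℛ₄ L Rc))
      (physA n L hn (lt_of_lt_of_le (by norm_num) hL) (ℛ₄ L Rc)) jhalf Unit Unit where
  Dec _ _ := ∅
  dec _ _ _ := ()
  Csl _ _ := ∅
  slice _ _ _ := ()
  v _ _ _ _ := 0
  N _ _ := 0
  died_empty K _ τ _ j _ := died_run_eq_empty₄ L Rc K τ j
  hsl K _ k hk := absurd hk (not_mem_badGMems₄ L Rc _ _ jhalf K k)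
  hmem K _ k hk := absurd hk (not_mem_badGMems₄ L Rc _ _ jhalf K k)
  hinj K _ k hk := absurd hk (not_mem_badGMems₄ L Rc _ _ jhalf K k)
  v_nonneg _ _ _ _ _ := le_rfl
  envelope K _ _ _ k hk := absurd hk (not_mem_badGMems₄ L Rc _ _ jhalf K k)
  hW K _ _ _ k hk := absurd hk (not_mem_badGMems₄ L Rc _ _ jhalf K k)
  card_Dec K _ k hk := absurd hk (not_mem_badGMems₄ L Rc _ _ jhalf K k)
  hN K e := by simpa using (Real.exp_pos _).le

/-! ## §9 The records' located display (ρ) on the toy THROUGH the custodian's one-liner -/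

variable (F : T4Family)

/-- **`HistReadData(L)`'s FIELD SHAPE `hρ` ON THE TOY OF PARTS 2∕3, FROM THE DECORATION ROAD** (`hρ_of_indexDecor` on
`indexDecor_toy₃`; source radius `1`, threshold `0`, any `W φB φR`) — the statement LITERALLY the records' field type at
the toy reading. [decided toy] -/
theorem hρ_toy₃_of_indexDecor (n : ℕ) (hn : 0 < n) (g : ℕ → ℕ → ℝ) (Z : ℕ → ℝ → ℝ) (W : ℕ → ℝ) (φB : ℕ → ℕ → ℕ → ℝ)
    (φR : ℕ → ℕ → ℝ) :
    ∀ K t, |t| ≤ 1 → 0 ≤ K →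
      ∀ k ∈ badGMems (memA n F.L (ℛ₃ F.L)) jhalf (HIndex.termSet Isk)
          (kmemA n F.L hn (lt_of_lt_of_le (by norm_num) (two_le_L F)) (ℛ₃ F.L)) K,
        ∑ τ ∈ fibre (kmemA n F.L hn (lt_of_lt_of_le (by norm_num) (two_le_L F)) (ℛ₃ F.L)) (HIndex.termSet Isk) K k,
          dmassOf (ℛ₃ F.L) (Φ₃ F.L g Z) t τ ≤ W K * MULTOf (sharpT (φB K) (φR K)) k :=
  hρ_of_indexDecor (ℛ₃ F.L) (Φ₃ F.L g Z) (indexDecor_toy₃ F.L n hn (two_le_L F) g Z 1 0 W φB φR)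

/-- **`HistReadDataLW`'s FIELD SHAPE `hρ` ON THE TOY OF PARTS 6∕7, FROM THE DECORATION ROAD** (`hρ_of_indexDecor` on
`indexDecor_toy₄`; envelope `W := 2`, shares `0` — part 6's letters). [decided toy] -/
theorem hρ_toy₄_of_indexDecor (Rc n : ℕ) (hn : 0 < n) (O : PrintedO1s) (m : ℝ) (C : T4PrintedShapeBanking.Consts) (Lr : ℝ)
    (p₁ : ℕ) (cΛ : ℝ) (g : ℕ → ℕ → ℝ) (Z : ℕ → ℝ → ℝ) (hΛ1 : ∀ K t, 1 ≤ lamVol cΛ (g K) K t) :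
    ∀ K t, |t| ≤ 1 → 0 ≤ K →
      ∀ k ∈ badGMems (memA n F.L (ℛ₄ F.L Rc)) jhalf (HIndex.termSet Isk)
          (kmemA n F.L hn (lt_of_lt_of_le (by norm_num) (two_le_L F)) (ℛ₄ F.L Rc)) K,
        ∑ τ ∈ fibre (kmemA n F.L hn (lt_of_lt_of_le (by norm_num) (two_le_L F)) (ℛ₄ F.L Rc)) (HIndex.termSet Isk) K k,
          dmassOf (ℛ₄ F.L Rc) (Φ₄ O m C Lr p₁ Rc cΛ g Z hΛ1) t τ ≤
            (2 : ℝ) * MULTOf (sharpT (fun _ _ => (0 : ℝ)) (fun _ => (0 : ℝ))) k :=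
  hρ_of_indexDecor (ℛ₄ F.L Rc) (Φ₄ O m C Lr p₁ Rc cΛ g Z hΛ1)
    (indexDecor_toy₄ F.L Rc n hn (two_le_L F) O m C Lr p₁ cΛ g Z hΛ1 1 0 (fun _ => 2) (fun _ _ _ => 0) fun _ _ => 0)

end

end Summit.QuantumFields.BalabanUV.T4Continuum.HistoryRealiseCellsRunAssemblyWTVSSanity
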